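import Summits.Ventures.Crystal3D.StickySpheres.ConeCertificates
import Mathlib.Algebra.BigOperators.Fin
import HarnessLib

/-!
# Cone-and-lookup certificates: a graph stratum from a complete list one size down, checked by the kernel

Venture `Crystal3D` (cell `pub-crystal3d`, seat p3). A GENERIC, kernel-checkable certificate format for the extension
step of `ExtensionStep.lean` in its most frequent shape (`D = d`: the new vertex has the minimum degree `d`, and every
refutation is a ONE-VERTEX DELETION LOOKUP into the SAME lower list, decided by cheap isomorphism invariants):

* graphs are given as ROW-BITMASK TABLES (`adjOfRows rows i j = testBit rows[i] j`); `tableGraph m rows` is the graph on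
  `Fin m` of a table (`⊥` if the table is not symmetric/irreflexive), `tableSet m tabs` the set of graphs of a list of
  tables — this is how a complete list `L` enters a hypothesis `CompleteListHypothesis d e m (tableSet m tabs)`;
* invariants: the degree histogram `histB` and the ordered-triangle count `triB` (`= triCount`, `∑_{a,b,c} [ab, ac, bc
  edges]`), both isomorphism invariants (`histB_eq_of_iso`, `triB_eq_of_iso`); `invNe a b = true` refutes `a ≅ b`;
* `testAll m d e' tabs` — the certificate: every table is a valid graph with `e'` edges, and for every table `T` and
  every `S ⊆ Fin m` (bitmask `c < 2^m`) with `|S| = d` whose cone `T ⊕ S` has all degrees `≥ d`, some vertex `w` of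
  degree `d` has `invNe ((T ⊕ S) − w, T') = true` for EVERY table `T'` of the list;
* **`graphStratum_of_testAll`**: `testAll m d e' tabs = true`, `2(e' + d) < (d + 1)(m + 1)` and
  `CompleteListHypothesis (d − 1) e' m (tableSet m tabs)` imply `GraphStratumHypothesis d (e' + d) (m + 1)`.
  Proof = `graphStratumHypothesis_succ_of_coneExtensions` + (cone of a table = table of the cone) + (deleting a
  degree-`d` vertex of the cone lands in the stratum `(d − 1, e', m)`, where the complete list forces an isomorphism
  with a listed table, contradicting `invNe`).

Instances: `ElevenVertexCones.lean` (`GSH(5,30,11)` from the three 25-edge graphs on 10 vertices),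
`TenVertexCones.lean` (`GSH(5,26,10)` from the five 21-edge graphs on 9 vertices with minimum degree `≥ 4`).
HONEST FRAMING: [folklore] bookkeeping + kernel arithmetic; the complete lists stay hypotheses.
-/

namespace Summit.Ventures.Crystal3D

open Finset SimpleGraph

/-! ### 1. Tables -/

section Tables

variable {m : ℕ}

/-- Adjacency table of a list of row bitmasks: `i ~ j` iff bit `j` of `rows[i]`. [folklore] -/
def adjOfRows (rows : List ℕ) (i j : Fin m) : Bool := (rows.getD i.val 0).testBit j.val

/-- Boolean symmetry check of a table. [folklore] -/
def symmB (adj : Fin m → Fin m → Bool) : Bool :=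
  (List.finRange m).all fun a => (List.finRange m).all fun b => decide (adj a b = adj b a)

/-- Boolean irreflexivity check of a table. [folklore] -/
def irreflB (adj : Fin m → Fin m → Bool) : Bool := (List.finRange m).all fun a => decide (adj a a = false)

/-- A table passing `symmB` is symmetric. [folklore] -/
theorem symm_of_symmB {adj : Fin m → Fin m → Bool} (h : symmB adj = true) : ∀ a b, adj a b = adj b a := by
  intro a b
  simp only [symmB, List.all_eq_true, List.mem_finRange, true_implies, decide_eq_true_eq] at h
  exact h a b

/-- A table passing `irreflB` is irreflexive. [folklore] -/
theorem irrefl_of_irreflB {adj : Fin m → Fin m → Bool} (h : irreflB adj = true) : ∀ a, adj a a = false := by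
  intro a
  simp only [irreflB, List.all_eq_true, List.mem_finRange, true_implies, decide_eq_true_eq] at h
  exact h a

/-- Row count (degree read off the table). [folklore] -/
def rowDeg (adj : Fin m → Fin m → Bool) (a : Fin m) : ℕ := (List.finRange m).countP fun b => adj a b

variable (m) in
/-- **The graph of a table** on `Fin m` (`⊥` if the table is not a symmetric irreflexive table). [folklore] -/
def tableGraph (rows : List ℕ) : SimpleGraph (Fin m) :=
  if h : symmB (adjOfRows rows : Fin m → Fin m → Bool) = true ∧ irreflB (adjOfRows rows : Fin m → Fin m → Bool) = true
  then boolGraph (adjOfRows rows) (symm_of_symmB h.1) (irrefl_of_irreflB h.2) else ⊥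

/-- A valid table's graph is its `boolGraph`. [folklore] -/
theorem tableGraph_eq {rows : List ℕ} (h1 : symmB (adjOfRows rows : Fin m → Fin m → Bool) = true)
    (h2 : irreflB (adjOfRows rows : Fin m → Fin m → Bool) = true) :
    tableGraph m rows = boolGraph (adjOfRows rows) (symm_of_symmB h1) (irrefl_of_irreflB h2) := by
  rw [tableGraph, dif_pos ⟨h1, h2⟩]

variable (m) in
/-- **The set of graphs of a list of tables** (how an explicit complete list is named in a hypothesis). [folklore] -/
def tableSet (tabs : List (List ℕ)) : Set (SimpleGraph (Fin m)) :=
  {X | ∃ k, k < tabs.length ∧ X = tableGraph m (tabs.getD k [])}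

/-- The table graph of a pulled-back table is the pulled-back graph (vertex deletion, in particular). [folklore] -/
theorem comap_boolGraph {k : ℕ} (adj : Fin m → Fin m → Bool) (hs : ∀ a b, adj a b = adj b a)
    (hl : ∀ a, adj a a = false) (f : Fin k → Fin m) :
    (boolGraph adj hs hl).comap f = boolGraph (fun a b => adj (f a) (f b)) (fun _ _ => hs _ _) (fun _ => hl _) := by
  ext a b
  rfl

/-- An isomorphism along an equality of graphs. [folklore] -/
def isoOfEq {V : Type*} {G G' : SimpleGraph V} (h : G = G') : G ≃g G' where
  toEquiv := Equiv.refl V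
  map_rel_iff' := by subst h; exact Iff.rfl

/-- Edge count of a table graph from the row counts. [folklore] -/
theorem two_mul_card_edgeFinset_boolGraph (adj : Fin m → Fin m → Bool) (hs : ∀ a b, adj a b = adj b a)
    (hl : ∀ a, adj a a = false) :
    2 * (boolGraph adj hs hl).edgeFinset.card = ((List.finRange m).map (rowDeg adj)).sum := by
  rw [← sum_degrees_eq_twice_card_edges, Fin.sum_univ_def]
  congr 1
  refine List.map_congr_left fun a _ => ?_
  exact degree_boolGraph adj hs hl a

/-! ### 2. Invariants -/

/-- Degree histogram of a table: entry `t` (`0 ≤ t ≤ m`) counts the rows with `t` set bits. [folklore] -/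
def histB (adj : Fin m → Fin m → Bool) : List ℕ :=
  (List.range (m + 1)).map fun t => (List.finRange m).countP fun v => decide (rowDeg adj v = t)

/-- Isomorphic table graphs have equal histograms. [folklore] -/
theorem histB_eq_of_iso {adj adj' : Fin m → Fin m → Bool} {hs hl hs' hl'}
    (φ : boolGraph adj hs hl ≃g boolGraph adj' hs' hl') : histB adj = histB adj' := by
  unfold histB
  refine List.map_congr_left fun t _ => ?_
  have h := card_filter_degree_eq_of_iso φ t
  rw [card_filter_univ_eq_countP, card_filter_univ_eq_countP] at h
  simp only [degree_boolGraph] at h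
  exact h

/-- Ordered triangle count of a finite graph: `∑_{a,b,c} [a~b ∧ a~c ∧ b~c]` (six times the number of triangles).
[folklore] -/
def triCount {V : Type*} [Fintype V] (G : SimpleGraph V) [DecidableRel G.Adj] : ℕ :=
  ∑ a, ∑ b, ∑ c, if G.Adj a b ∧ G.Adj a c ∧ G.Adj b c then 1 else 0

/-- `triCount` is an isomorphism invariant. [folklore] -/
theorem triCount_eq_of_iso {V W : Type*} [Fintype V] [Fintype W] {G : SimpleGraph V} {H : SimpleGraph W}
    [DecidableRel G.Adj] [DecidableRel H.Adj] (φ : G ≃g H) : triCount G = triCount H := by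
  unfold triCount
  rw [← Equiv.sum_comp φ.toEquiv]
  refine Finset.sum_congr rfl fun a _ => ?_
  rw [← Equiv.sum_comp φ.toEquiv]
  refine Finset.sum_congr rfl fun b _ => ?_
  rw [← Equiv.sum_comp φ.toEquiv]
  refine Finset.sum_congr rfl fun c _ => ?_
  simp only [RelIso.coe_fn_toEquiv, Iso.map_adj_iff]

/-- Ordered triangle count read off a table. [folklore] -/
def triB (adj : Fin m → Fin m → Bool) : ℕ :=
  ((List.finRange m).map fun a =>
    ((List.finRange m).map fun b => (List.finRange m).countP fun c => adj a b && (adj a c && adj b c)).sum).sum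

/-- `triCount` of a table graph is `triB` of the table. [folklore] -/
theorem triCount_boolGraph (adj : Fin m → Fin m → Bool) (hs : ∀ a b, adj a b = adj b a) (hl : ∀ a, adj a a = false) :
    triCount (boolGraph adj hs hl) = triB adj := by
  unfold triCount triB
  rw [Fin.sum_univ_def]
  congr 1
  refine List.map_congr_left fun a _ => ?_
  rw [Fin.sum_univ_def]
  congr 1
  refine List.map_congr_left fun b _ => ?_
  rw [Finset.sum_boole, Nat.cast_id, card_filter_univ_eq_countP]
  congr 1
  funext c
  simp only [boolGraph_adj, Bool.decide_and, Bool.decide_eq_true]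

/-- Isomorphic table graphs have equal triangle counts. [folklore] -/
theorem triB_eq_of_iso {adj adj' : Fin m → Fin m → Bool} {hs hl hs' hl'}
    (φ : boolGraph adj hs hl ≃g boolGraph adj' hs' hl') : triB adj = triB adj' := by
  rw [← triCount_boolGraph adj hs hl, ← triCount_boolGraph adj' hs' hl']
  exact triCount_eq_of_iso φ

/-- `invNe a b`: the histograms or the triangle counts of the tables `a`, `b` differ (histogram first). [folklore] -/
def invNe (a b : Fin m → Fin m → Bool) : Bool := !decide (histB a = histB b) || !decide (triB a = triB b)

/-- `invNe a b = true` refutes `boolGraph a ≅ boolGraph b`. [folklore] -/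
theorem not_iso_of_invNe {adj adj' : Fin m → Fin m → Bool} {hs hl hs' hl'} (h : invNe adj adj' = true)
    (φ : boolGraph adj hs hl ≃g boolGraph adj' hs' hl') : False := by
  rw [invNe, Bool.or_eq_true, Bool.not_eq_true', decide_eq_false_iff_not, Bool.not_eq_true',
    decide_eq_false_iff_not] at h
  rcases h with h | h
  · exact h (histB_eq_of_iso φ)
  · exact h (triB_eq_of_iso φ)

/-! ### 3. The certificate -/

/-- Table of `G − w` (pull back along `w.succAbove`). [folklore] -/
def delAdj (adjG : Fin (m + 1) → Fin (m + 1) → Bool) (w : Fin (m + 1)) (i j : Fin m) : Bool :=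
  adjG (w.succAbove i) (w.succAbove j)

/-- A table is a valid graph table with `e'` edges. [folklore] -/
def tableOK (e' : ℕ) (adj : Fin m → Fin m → Bool) : Bool :=
  symmB adj && irreflB adj && decide (((List.finRange m).map (rowDeg adj)).sum = 2 * e')

/-- The test of one cone `T ⊕ S` (`S` as an indicator): `|S| ≠ d`, or some degree `< d`, or a degree-`d` vertex `w`
with `(T ⊕ S) − w` separated by `invNe` from every listed table. [folklore] -/
def testCone (d : ℕ) (tabs : List (List ℕ)) (adj : Fin m → Fin m → Bool) (s : Fin m → Bool) : Bool :=
  !decide ((List.finRange m).countP s = d) ||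
  !((List.finRange (m + 1)).all fun a => decide (d ≤ rowDeg (coneAdjB adj s) a)) ||
  (List.finRange (m + 1)).any fun w => decide (rowDeg (coneAdjB adj s) w = d) &&
    (List.range tabs.length).all fun k => invNe (delAdj (coneAdjB adj s) w) (adjOfRows (tabs.getD k []))

variable (m) in
/-- **The certificate:** every table is valid with `e'` edges and every cone over every table passes `testCone`.
[folklore] -/
def testAll (d e' : ℕ) (tabs : List (List ℕ)) : Bool :=
  (List.range tabs.length).all fun k =>
    tableOK e' (adjOfRows (tabs.getD k []) : Fin m → Fin m → Bool) &&
    (List.range (2 ^ m)).all fun c => testCone d tabs (adjOfRows (tabs.getD k []) : Fin m → Fin m → Bool) (maskFun c)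

end Tables

/-! ### 4. Soundness -/

/-- **Soundness of cone-and-lookup certificates.** If `testAll m d e' tabs = true`,
`2(e' + d) < (d + 1)(m + 1)`, and the graphs of `tabs` form a complete list for the stratum `(d − 1, e', m)`, then no graph on
`m + 1` vertices with `e' + d` edges and minimum degree `≥ d` is relaxed-realisable. [folklore] -/
theorem graphStratum_of_testAll {m d e' : ℕ} (tabs : List (List ℕ))
    (hD : 2 * (e' + d) < (d + 1) * (m + 1)) (hcheck : testAll m d e' tabs = true)
    (hBase : CompleteListHypothesis (d - 1) e' m (tableSet m tabs)) :
    GraphStratumHypothesis d (e' + d) (m + 1) := by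
  -- facts about a listed table `k`
  have hTab : ∀ k, k < tabs.length →
      tableOK e' (adjOfRows (tabs.getD k []) : Fin m → Fin m → Bool) = true ∧
      ∀ c, c ∈ List.range (2 ^ m) →
        testCone d tabs (adjOfRows (tabs.getD k []) : Fin m → Fin m → Bool) (maskFun c) = true := by
    intro k hk
    have h := List.all_eq_true.1 hcheck k (List.mem_range.2 hk)
    rw [Bool.and_eq_true, List.all_eq_true] at h
    exact ⟨h.1, fun c hc => h.2 c hc⟩
  have hOK : ∀ k, k < tabs.length →
      symmB (adjOfRows (tabs.getD k []) : Fin m → Fin m → Bool) = true ∧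
      irreflB (adjOfRows (tabs.getD k []) : Fin m → Fin m → Bool) = true ∧
      ((List.finRange m).map (rowDeg (adjOfRows (tabs.getD k []) : Fin m → Fin m → Bool))).sum = 2 * e' := by
    intro k hk
    have h := (hTab k hk).1
    rw [tableOK, Bool.and_eq_true, Bool.and_eq_true, decide_eq_true_eq] at h
    exact ⟨h.1.1, h.1.2, h.2⟩
  refine graphStratumHypothesis_succ_of_coneExtensions (n := m) (e := e' + d) (d := d) (D := d) hD
    (fun _ => tableSet m tabs) ?_ ?_
  · intro d' h1 h2
    obtain rfl : d = d' := le_antisymm h1 h2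
    rw [Nat.add_sub_cancel]
    exact hBase
  intro d' h1 h2 H hH inst S hS hmin hRR
  obtain rfl : d = d' := le_antisymm h1 h2
  obtain ⟨k, hk, rfl⟩ := hH
  obtain ⟨hks, hkl, hksum⟩ := hOK k hk
  -- name the table, the indicator and the cone table graph
  set adj : Fin m → Fin m → Bool := adjOfRows (tabs.getD k []) with hadj
  have hT : tableGraph m (tabs.getD k []) = boolGraph adj (symm_of_symmB hks) (irrefl_of_irreflB hkl) :=
    tableGraph_eq hks hkl
  set s : Fin m → Bool := fun i => decide (i ∈ S) with hs
  let G' : SimpleGraph (Fin (m + 1)) :=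
    boolGraph (coneAdjB adj s) (coneAdjB_symm _ (symm_of_symmB hks) s) (coneAdjB_irrefl _ (irrefl_of_irreflB hkl) s)
  have hEq : coneGraph (Fin.last m) (tableGraph m (tabs.getD k [])) S = G' := by
    rw [hT]
    conv_lhs => rw [eq_filter_decide_mem S]
    exact coneGraph_boolGraph adj _ _ s
  have hdegG' : ∀ a, G'.degree a = rowDeg (coneAdjB adj s) a := fun a => degree_boolGraph _ _ _ a
  have hmin' : ∀ a, d ≤ G'.degree a := fun a => by
    rw [← degree_congr_of_eq hEq a]
    exact hmin a
  have hRR' : RelaxedRealisable G' := hEq ▸ hRR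
  -- edge count of the cone: e' + d
  have hE0 : (boolGraph adj (symm_of_symmB hks) (irrefl_of_irreflB hkl)).edgeFinset.card = e' := by
    have h := two_mul_card_edgeFinset_boolGraph adj (symm_of_symmB hks) (irrefl_of_irreflB hkl)
    rw [hksum] at h
    omega
  have hcardG' : G'.edgeFinset.card = e' + d := by
    rw [← card_edgeFinset_congr_of_eq hEq, card_edgeFinset_coneGraph, card_edgeFinset_congr_of_eq hT, hE0, hS]
  -- the certificate line for this cone
  have ht := (hTab k hk).2 (∑ j ∈ S, 2 ^ (j : ℕ)) (sum_two_pow_val_mem_range S)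
  rw [maskFun_sum_two_pow, ← hs] at ht
  have h1 : (List.finRange m).countP s = d := by rw [hs, ← card_eq_countP_decide_mem S, hS]
  have h2 : ((List.finRange (m + 1)).all fun a => decide (d ≤ rowDeg (coneAdjB adj s) a)) = true := by
    rw [List.all_eq_true]
    intro a _
    rw [decide_eq_true_eq, ← hdegG' a]
    exact hmin' a
  rw [testCone, h1, h2] at ht
  simp only [decide_true, Bool.not_true, Bool.false_or, List.any_eq_true, Bool.and_eq_true, decide_eq_true_eq,
    List.all_eq_true, List.mem_range] at ht
  obtain ⟨w, -, hw, hall⟩ := ht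
  rw [← hdegG' w] at hw
  -- delete `w`: the result lies in the base stratum, so it is isomorphic to a listed table graph
  have hdel : G'.comap w.succAbove = boolGraph (delAdj (coneAdjB adj s) w)
      (fun _ _ => coneAdjB_symm _ (symm_of_symmB hks) s _ _)
      (fun _ => coneAdjB_irrefl _ (irrefl_of_irreflB hkl) s _) :=
    comap_boolGraph _ _ _ _
  have he : (G'.comap w.succAbove).edgeFinset.card = e' := by
    rw [card_edgeFinset_comap_succAbove, hcardG', hw, Nat.add_sub_cancel]
  have hdg : ∀ j, d - 1 ≤ (G'.comap w.succAbove).degree j := fun j =>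
    le_trans (Nat.sub_le_sub_right (hmin' (w.succAbove j)) 1) (degree_sub_one_le_degree_comap_succAbove G' w j)
  obtain ⟨X, hX, ⟨φ⟩⟩ := hBase (G'.comap w.succAbove) he hdg (hRR'.deleteVertex w)
  obtain ⟨k', hk', rfl⟩ := hX
  obtain ⟨hks', hkl', -⟩ := hOK k' hk'
  have ψ := ((isoOfEq hdel).symm.trans φ).trans (isoOfEq (tableGraph_eq hks' hkl'))
  exact not_iso_of_invNe (hall k' hk') ψ

/-- The same, packaged as a row of the table: if also `C(m) = t` is known … (users compose with `GraphStratum.lean`).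
Restated for convenience with `e = e' + d` supplied explicitly. [folklore] -/
theorem graphStratum_of_testAll' {m d e' e : ℕ} (tabs : List (List ℕ)) (he : e = e' + d)
    (hD : 2 * e < (d + 1) * (m + 1)) (hcheck : testAll m d e' tabs = true)
    (hBase : CompleteListHypothesis (d - 1) e' m (tableSet m tabs)) :
    GraphStratumHypothesis d e (m + 1) := by
  subst he
  exact graphStratum_of_testAll tabs hD hcheck hBase

end Summit.Ventures.Crystal3D
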